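import Literature.AlgebraicGeometry.Modules.GrothendieckComplexOfProper
import Literature.AlgebraicGeometry.Morphisms.SectionsLiftOfFibreVanishing
import Literature.AlgebraicGeometry.Modules.PullbackQuasicoherent
import Literature.AlgebraicGeometry.Modules.ModuleSectionsFlatBaseChange
import Mathlib.Algebra.Category.ModuleCat.Descent
import Mathlib.Algebra.Category.ModuleCat.Abelian
import Mathlib.Algebra.Homology.QuasiIso
import Mathlib.Algebra.Homology.ShortComplex.PreservesHomology
import Mathlib.RingTheory.Flat.FaithfullyFlat.Basic
import Mathlib.RingTheory.RingHom.FaithfullyFlat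
import HarnessLib

/-!
# Cohomology of quasi-coherent modules commutes with FLAT base change, in ALL degrees; field extensions
# (The Stacks Project, Tag 02KH; Hartshorne III Prop. 9.3; EGA III 1.4.15; Görtz–Wedhorn II, Cor. 22.91)

Topic `AlgebraicGeometry/Modules`; namespace `Literature.AlgebraicGeometry.Modules`; a *proofs* file (theorems only;
no definition, no named fact, no instance, no notation).

The Stacks Project, Tag 02KH (Cohomology of Schemes, Lemma 30.5.2): «Let `f : X → S` be quasi-compact and
quasi-separated, `S' → S` FLAT, `𝓕` quasi-coherent. Then `Hⁱ(X', 𝓕') = Hⁱ(X, 𝓕) ⊗ …` / the base change map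
`g^* Rⁱf_* 𝓕 → Rⁱf'_* (g')^*𝓕` is an isomorphism»; Hartshorne III Prop. 9.3; for an AFFINE base and its most used
special case, a field extension `K → L`: Görtz–Wedhorn II, Cor. 22.91 «`Hⁱ(X ⊗_k K, 𝓕_K) = Hⁱ(X, 𝓕) ⊗_k K`».
The tree has the statement in degree `0` (★ `Modules/ModuleSectionsFlatBaseChange`, ★
`Morphisms/SectionsRankOneIffGeometricallyConnected` for `𝒪_X`), on the total derived functor (★
`Modules/DerivedFlatBaseChange`), and — the two inputs composed here — at the level of ČECH COMPLEXES (★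
`Modules/GrothendieckComplexOfProper.exists_extendScalars_cechComplex_iso_of_isPullback`:
`Č•(k⁻¹𝓤, k^*G) ≅ Γ(B') ⊗_{Γ(B)} Č•(𝓤, G)` for ANY cartesian square over affine `B, B'`) together with the
dictionary ★ `Modules/ModuleCechFiniteOfProper.exists_ext_addEquiv_homology_cechComplex`
(`Extⁿ⁺¹_{𝒪_X}(𝒪_X, G) ≃ Hⁿ⁺¹(Č•(𝓤, G))`).  This file adds the one missing homological-algebra step — homology
commutes with extension of scalars along a FLAT ring map (Mathlib: `ModuleCat.preservesFiniteLimits_extendScalars_of_flat`,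
`ShortComplex.mapHomologyIso`) — and reads off the cohomology groups in all degrees:

* §1 (algebra) `nonempty_tensor_homology_linearEquiv_extendScalars_of_flat` — `R ⊗_A Hⁿ(C) ≃ₗ[R] Hⁿ(R ⊗_A C)` for
  `f : A → R` flat and any cochain complex `C` of `A`-modules; `subsingleton_homology_extendScalars_iff_of_faithfullyFlat`;
  `finrank_homology_extendScalars_eq_of_free`.
* §2 (Čech cohomology, affine bases) for a cartesian square `k ≫ g = g' ≫ j` with `B, B'` affine, a finite family
  `𝓤` of opens of `X` with affine non-empty finite intersections and `G` affine-localizing (quasi-coherent):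
  **`nonempty_tensor_homology_cechComplex_linearEquiv_of_flat`** — `Γ(B') ⊗_{Γ(B)} Hⁿ(Č•(𝓤, G)) ≃ₗ[Γ(B')]
  Hⁿ(Č•(k⁻¹𝓤, k^*G))` when `j♯` is flat; **`subsingleton_homology_cechComplex_iff_of_faithfullyFlat`** when `j♯`
  is faithfully flat.
* §3 (`Ext` dialect) **`subsingleton_ext_unit_succ_iff_of_faithfullyFlat`** — for `𝓤` moreover a cover:
  `Extⁿ⁺¹(𝒪_{X'}, k^*G) = 0 ↔ Extⁿ⁺¹(𝒪_X, G) = 0`; cover-free form `…_of_isProper` for `g` proper.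
* §4 (field extensions `φ : K → L`, `j = Spec φ`, `g` proper, `G` quasi-coherent, ANY cartesian square — so that
  every presentation of the base-changed scheme is served):
  **`subsingleton_ext_unit_succ_iff_of_isPullback_specMap`** (VANISHING of `Hⁿ⁺¹` is invariant under field
  extension), **`finrank_homology_cechComplex_eq_of_isPullback_specMap`** (`dim_L Hⁿ(Č•_L) = dim_K Hⁿ(Č•_K)`),
  **`finrank_secMod_top_eq_of_isPullback_specMap`** (`dim_L Γ(X_L, G_L) = dim_K Γ(X, G)`; scalars are the rings
  `Γ(Spec K, 𝒪)`, `Γ(Spec L, 𝒪)` of the (h2) chain) and its field-scalar form `finrank_secMod_top_eq_of_isPullback_specMap'`.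

Everything is proved; no named facts.  Universe `Scheme.{0}` (the universe of the module Čech dialect).  Mathlib
searched (pin): `ModuleCat.preservesFiniteLimits_extendScalars_of_flat`, `Adjunction.leftAdjoint_preservesColimits`,
`Functor.preservesHomologyOfExact`, `ShortComplex.mapHomologyIso`, `Module.FaithfullyFlat.subsingleton_tensorProduct_iff_right`,
`Module.finrank_baseChange`, `RingHom.FaithfullyFlat.respectsIso`, `Scheme.Hom.flat_appLE`, `IsField.toField` (used);
Mathlib has no Čech cohomology of quasi-coherent modules and no cohomology-and-base-change.  Cell `hodgecm-mathlib`,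
F-DAG F-2 (b) (field case of [MFK94] Prop. 6.13) SPREAD side (B-p11 (g17); census lead B-p05 (g17)); generic,
count-neutral, books 0.  HC_CM is proved only modulo the 7 printed citations until rung 0 closes — nothing here bears on
a summit statement.

## References

* The Stacks Project, Tag 02KH (Cohomology of Schemes, Lemma 30.5.2, flat base change). [StacksProject]
* R. Hartshorne, *Algebraic Geometry*, GTM 52 (1977), III Prop. 9.3 (p. 255). [Hartshorne1977]
* A. Grothendieck, J. Dieudonné, EGA III₁ (Publ. Math. IHÉS 11, 1961), Prop. (1.4.15). [EGAIII1]
* U. Görtz, T. Wedhorn, *Algebraic Geometry II: Cohomology of Schemes* (2023), Prop. 22.90, Cor. 22.91 (p. 277).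
  [GortzWedhorn2023]
-/

noncomputable section

set_option backward.isDefEq.respectTransparency false

open CategoryTheory CategoryTheory.Limits Opposite TopologicalSpace AlgebraicGeometry TensorProduct
open CategoryTheory.Abelian
open Literature.Algebra.Homology

universe u

/-! ## §1 Homology commutes with flat extension of scalars -/

namespace Literature.Algebra.Homology

variable {A R : Type u} [CommRing A] [CommRing R] (f : A →+* R)

/-- **Homology commutes with FLAT extension of scalars**: for `f : A → R` flat and a cochain complex `C` of
`A`-modules, `R ⊗_A Hⁿ(C) ≃ₗ[R] Hⁿ(R ⊗_A C)` (extension of scalars is exact for `f` flat —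
Mathlib `ModuleCat.preservesFiniteLimits_extendScalars_of_flat` and the adjunction `extendScalars ⊣ restrictScalars` —
hence preserves homology, `ShortComplex.mapHomologyIso`). [cite: StacksProject, Tag 02KH] [cite: GortzWedhorn2023, Cor. 22.91 (p. 277)] -/
theorem nonempty_tensor_homology_linearEquiv_extendScalars_of_flat (hf : f.Flat)
    (C : CochainComplex (ModuleCat.{u} A) ℤ) (n : ℤ) :
    letI := f.toAlgebra
    Nonempty (R ⊗[A] (C.homology n) ≃ₗ[R]
      (((ModuleCat.extendScalars.{u, u, u} f).mapHomologicalComplex (ComplexShape.up ℤ)).obj C).homology n) := by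
  letI := f.toAlgebra
  let F := ModuleCat.extendScalars.{u, u, u} f
  haveI : PreservesFiniteLimits F := ModuleCat.preservesFiniteLimits_extendScalars_of_flat hf
  haveI : PreservesColimitsOfSize.{u, u} F := (ModuleCat.extendRestrictScalarsAdj f).leftAdjoint_preservesColimits
  haveI : PreservesFiniteColimits F := inferInstance
  let e : ((F.mapHomologicalComplex (ComplexShape.up ℤ)).obj C).homology n ≅ F.obj (C.homology n) :=
    (C.sc n).mapHomologyIso F
  exact ⟨e.symm.toLinearEquiv⟩

/-- Over a FAITHFULLY flat `f : A → R`, `Hⁿ(R ⊗_A C) = 0 ↔ Hⁿ(C) = 0`. [cite: StacksProject, Tag 02KH] -/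
theorem subsingleton_homology_extendScalars_iff_of_faithfullyFlat (hf : f.FaithfullyFlat)
    (C : CochainComplex (ModuleCat.{u} A) ℤ) (n : ℤ) :
    Subsingleton ((((ModuleCat.extendScalars.{u, u, u} f).mapHomologicalComplex (ComplexShape.up ℤ)).obj C).homology n)
      ↔ Subsingleton (C.homology n) := by
  letI := f.toAlgebra
  haveI : Module.FaithfullyFlat A R := hf
  obtain ⟨E⟩ := nonempty_tensor_homology_linearEquiv_extendScalars_of_flat f hf.flat C n
  rw [← E.toEquiv.subsingleton_congr]
  exact Module.FaithfullyFlat.subsingleton_tensorProduct_iff_right A R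

/-- Over a flat `f : A → R` of rings with the strong rank condition, `rank_R Hⁿ(R ⊗_A C) = rank_A Hⁿ(C)` whenever
`Hⁿ(C)` is a free `A`-module (e.g. `A` a field). [cite: GortzWedhorn2023, Cor. 22.91 (p. 277)] -/
theorem finrank_homology_extendScalars_eq_of_free [StrongRankCondition A] [StrongRankCondition R] (hf : f.Flat)
    (C : CochainComplex (ModuleCat.{u} A) ℤ) (n : ℤ) [Module.Free A (C.homology n)] :
    Module.finrank R ((((ModuleCat.extendScalars.{u, u, u} f).mapHomologicalComplex (ComplexShape.up ℤ)).obj C).homology n)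
      = Module.finrank A (C.homology n) := by
  letI := f.toAlgebra
  obtain ⟨E⟩ := nonempty_tensor_homology_linearEquiv_extendScalars_of_flat f hf C n
  rw [← E.finrank_eq, Module.finrank_baseChange]

end Literature.Algebra.Homology

namespace Literature.AlgebraicGeometry.Modules

open Literature.AlgebraicGeometry.Morphisms Literature.AlgebraicGeometry.HodgeTheory Literature.AlgebraicGeometry.Motives

/-! ## §2 Čech cohomology of a quasi-coherent module under flat affine base change -/

section Cech

variable {X B X' B' : Scheme.{0}} {g : X ⟶ B} {g' : X' ⟶ B'} {k : X' ⟶ X} {j : B' ⟶ B}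
  [IsAffine B] [IsAffine B'] (H : IsPullback k g' g j)
  {ι : Type} [LinearOrder ι] [Fintype ι] (U : ι → X.Opens)
  (hUa : ∀ s : Finset ι, s.Nonempty → IsAffineOpen (cechOpen U s)) (G : X.Modules)

include H hUa in
/-- **Flat base change of Čech cohomology, all degrees** (Stacks 02KH; Görtz–Wedhorn II Prop. 22.90 / Cor. 22.91):
for a cartesian square `k ≫ g = g' ≫ j` over an affine `j : B' → B` with `j♯ : Γ(B, 𝒪) → Γ(B', 𝒪)` FLAT, a
finite family `𝓤` of opens of `X` with affine non-empty intersections and an affine-localizing (quasi-coherent)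
`𝒪_X`-module `G`: `Γ(B') ⊗_{Γ(B)} Hⁿ(Č•(𝓤, G)) ≃ₗ[Γ(B')] Hⁿ(Č•(k⁻¹𝓤, k^*G))` (base rings `g♯`, `g'♯`).
[cite: StacksProject, Tag 02KH] [cite: GortzWedhorn2023, Prop. 22.90 and Cor. 22.91 (p. 277)] [cite: Hartshorne1977, III Prop. 9.3 (p. 255)] -/
theorem nonempty_tensor_homology_cechComplex_linearEquiv_of_flat (hG : IsAffineLocalizing G)
    (hflat : (j.appLE ⊤ ⊤ le_top).hom.Flat) (n : ℤ) :
    letI := (j.appLE ⊤ ⊤ le_top).hom.toAlgebra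
    Nonempty (Γ(B', ⊤) ⊗[Γ(B, ⊤)] ((cechComplex U G g.appTop.hom).homology n) ≃ₗ[Γ(B', ⊤)]
      ((cechComplex (fun i => k ⁻¹ᵁ U i) ((Scheme.Modules.pullback k).obj G) g'.appTop.hom).homology n)) := by
  letI := (j.appLE ⊤ ⊤ le_top).hom.toAlgebra
  obtain ⟨Φ, -⟩ := exists_extendScalars_cechComplex_iso_of_isPullback H U hUa G hG
  obtain ⟨E⟩ := nonempty_tensor_homology_linearEquiv_extendScalars_of_flat (j.appLE ⊤ ⊤ le_top).hom hflat
    (cechComplex U G g.appTop.hom) n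
  exact ⟨E.trans (HomologicalComplex.homologyMapIso Φ n).toLinearEquiv⟩

include H hUa in
/-- **Vanishing of Čech cohomology is invariant under FAITHFULLY flat affine base change**:
`Hⁿ(Č•(k⁻¹𝓤, k^*G)) = 0 ↔ Hⁿ(Č•(𝓤, G)) = 0` when `j♯` is faithfully flat (e.g. `j` flat and surjective, ★
`Morphisms.faithfullyFlat_appLE`; a field extension). [cite: StacksProject, Tag 02KH] [cite: GortzWedhorn2023, Cor. 22.91 (p. 277)] -/
theorem subsingleton_homology_cechComplex_iff_of_faithfullyFlat (hG : IsAffineLocalizing G)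
    (hff : (j.appLE ⊤ ⊤ le_top).hom.FaithfullyFlat) (n : ℤ) :
    Subsingleton ((cechComplex (fun i => k ⁻¹ᵁ U i) ((Scheme.Modules.pullback k).obj G) g'.appTop.hom).homology n)
      ↔ Subsingleton ((cechComplex U G g.appTop.hom).homology n) := by
  obtain ⟨Φ, -⟩ := exists_extendScalars_cechComplex_iso_of_isPullback H U hUa G hG
  rw [← ((HomologicalComplex.homologyMapIso Φ n).toLinearEquiv.toEquiv.subsingleton_congr)]
  exact subsingleton_homology_extendScalars_iff_of_faithfullyFlat _ hff _ n

include H hUa in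
omit [LinearOrder ι] [Fintype ι] in
/-- The members of `k⁻¹𝓤` have affine non-empty finite intersections (`k` is affine, being a base change of the
morphism `j` of affine schemes). [cite: GortzWedhorn2023, Prop. 22.90 (p. 277), proof] -/
theorem isAffineOpen_cechOpen_preimage (s : Finset ι) (hs : s.Nonempty) :
    IsAffineOpen (cechOpen (fun i => k ⁻¹ᵁ U i) s) := by
  haveI : IsAffineHom j := isAffineHom_of_isAffine j
  haveI : IsAffineHom k := MorphismProperty.of_isPullback H.flip ‹IsAffineHom j›
  rw [← preimage_cechOpen]
  exact (hUa s hs).preimage k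

omit [IsAffine B] [IsAffine B'] [LinearOrder ι] [Fintype ι] hUa in
/-- `k⁻¹𝓤` covers `X'` when `𝓤` covers `X`. [folklore] -/
private theorem iSup_preimage_eq_top (hcov : ⨆ i, U i = ⊤) : ⨆ i, k ⁻¹ᵁ U i = ⊤ := by
  rw [← Scheme.Hom.preimage_iSup, hcov, Scheme.Hom.preimage_top]

end Cech

/-! ## §3 The `Ext` dialect -/

section Ext

variable {X B X' B' : Scheme.{0}} {g : X ⟶ B} {g' : X' ⟶ B'} {k : X' ⟶ X} {j : B' ⟶ B}
  [IsAffine B] [IsAffine B'] (H : IsPullback k g' g j)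
  {ι : Type} [LinearOrder ι] [Fintype ι] (U : ι → X.Opens) (hcov : ⨆ i, U i = ⊤)
  (hUa : ∀ s : Finset ι, s.Nonempty → IsAffineOpen (cechOpen U s)) (G : X.Modules)

include H hcov hUa in
/-- **Vanishing of `Extⁿ⁺¹(𝒪_X, G)` is invariant under faithfully flat affine base change** (Stacks 02KH / Görtz–Wedhorn II
Cor. 22.91 read through ordered Leray ★ `exists_ext_addEquiv_homology_cechComplex` on both sides): for a cartesian square
`k ≫ g = g' ≫ j` over affine `B, B'` with `j♯` faithfully flat, `X` admitting a finite cover `𝓤` with affine non-empty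
finite intersections (e.g. `g` quasi-compact separated) and `G` affine-localizing (quasi-coherent),
`Extⁿ⁺¹(𝒪_{X'}, k^*G) = 0 ↔ Extⁿ⁺¹(𝒪_X, G) = 0`. [cite: StacksProject, Tag 02KH] [cite: GortzWedhorn2023, Cor. 22.91 (p. 277)] -/
theorem subsingleton_ext_unit_succ_iff_of_faithfullyFlat (hG : IsAffineLocalizing G)
    (hff : (j.appLE ⊤ ⊤ le_top).hom.FaithfullyFlat) (n : ℕ) :
    Subsingleton (Ext.{1} (unitModule X') ((Scheme.Modules.pullback k).obj G) (n + 1))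
      ↔ Subsingleton (Ext.{1} (unitModule X) G (n + 1)) := by
  obtain ⟨e, -⟩ := exists_ext_addEquiv_homology_cechComplex g U hcov hUa G hG n
  obtain ⟨e', -⟩ := exists_ext_addEquiv_homology_cechComplex g' (fun i => k ⁻¹ᵁ U i)
    (iSup_preimage_eq_top U hcov) (isAffineOpen_cechOpen_preimage H U hUa)
    ((Scheme.Modules.pullback k).obj G) (hG.pullback k) n
  rw [e'.toEquiv.subsingleton_congr, e.toEquiv.subsingleton_congr]
  exact subsingleton_homology_cechComplex_iff_of_faithfullyFlat H U hUa G hG hff _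

include H in
/-- **Cover-free form for `g` proper**: `Extⁿ⁺¹(𝒪_{X'}, k^*G) = 0 ↔ Extⁿ⁺¹(𝒪_X, G) = 0` for a cartesian square over a
faithfully flat affine `j : B' → B`, `g : X → B` proper, `G` affine-localizing (the cover is ★
`Morphisms.exists_finite_affine_cover_cechOpen`). [cite: StacksProject, Tag 02KH] [cite: GortzWedhorn2023, Cor. 22.91 (p. 277)] -/
theorem subsingleton_ext_unit_succ_iff_of_faithfullyFlat_of_isProper [IsProper g] (hG : IsAffineLocalizing G)
    (hff : (j.appLE ⊤ ⊤ le_top).hom.FaithfullyFlat) (n : ℕ) :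
    Subsingleton (Ext.{1} (unitModule X') ((Scheme.Modules.pullback k).obj G) (n + 1))
      ↔ Subsingleton (Ext.{1} (unitModule X) G (n + 1)) := by
  obtain ⟨ι, _, _, U, hcov, hUa⟩ := exists_finite_affine_cover_cechOpen g
  exact subsingleton_ext_unit_succ_iff_of_faithfullyFlat H U hcov hUa G hG hff n

end Ext

/-! ## §4 Field extensions -/

section Field

variable {K L : Type} [Field K] [Field L] (φ : K →+* L)
  {X X' : Scheme.{0}} {g : X ⟶ Spec (.of K)} {g' : X' ⟶ Spec (.of L)} {k : X' ⟶ X}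
  (H : IsPullback k g' g (Spec.map (CommRingCat.ofHom φ))) (G : X.Modules)

/-- `(Spec φ).appLE ⊤ ⊤ = (Spec φ).appTop`. [folklore] -/
private theorem appLE_top_top {S₀ S : Scheme.{0}} (h : S₀ ⟶ S) : h.appLE ⊤ ⊤ le_top = h.appTop := by
  rw [Scheme.Hom.appTop, Scheme.Hom.app_eq_appLE]
  rfl

/-- On global sections `Spec φ` is `ΓSpecIso⁻¹ ∘ φ ∘ ΓSpecIso`. [folklore] -/
private theorem appLE_specMap_hom_eq :
    ((Spec.map (CommRingCat.ofHom φ)).appLE ⊤ ⊤ le_top).hom =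
      ((Scheme.ΓSpecIso (.of L)).inv.hom.comp φ).comp (Scheme.ΓSpecIso (.of K)).hom.hom := by
  rw [appLE_top_top]
  have h := Scheme.ΓSpecIso_inv_naturality (CommRingCat.ofHom φ)
  have h' : (Spec.map (CommRingCat.ofHom φ)).appTop =
      (Scheme.ΓSpecIso (.of K)).hom ≫ CommRingCat.ofHom φ ≫ (Scheme.ΓSpecIso (.of L)).inv := by
    rw [h, Iso.hom_inv_id_assoc]
  rw [h']
  rfl

/-- A homomorphism of fields is faithfully flat, and so is `(Spec φ)♯` on global sections. [folklore] -/
private theorem faithfullyFlat_appLE_specMap :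
    ((Spec.map (CommRingCat.ofHom φ)).appLE ⊤ ⊤ le_top).hom.FaithfullyFlat := by
  have hφ : φ.FaithfullyFlat := by
    letI := φ.toAlgebra
    exact RingHom.faithfullyFlat_algebraMap_iff.mpr (inferInstance : Module.FaithfullyFlat K L)
  rw [appLE_specMap_hom_eq]
  have h1 : ((Scheme.ΓSpecIso (.of L)).inv.hom.comp φ).FaithfullyFlat :=
    RingHom.FaithfullyFlat.respectsIso.1 φ (Scheme.ΓSpecIso (.of L)).symm.commRingCatIsoToRingEquiv hφ
  exact RingHom.FaithfullyFlat.respectsIso.2 _ (Scheme.ΓSpecIso (.of K)).commRingCatIsoToRingEquiv h1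

/-- `Γ(Spec K, 𝒪)` is a field. [folklore] -/
private theorem isField_Γ_spec (K : Type) [Field K] : IsField Γ(Spec (CommRingCat.of K), ⊤) :=
  MulEquiv.isField (Field.toIsField K) (Scheme.ΓSpecIso (.of K)).commRingCatIsoToRingEquiv.toMulEquiv

include H in
/-- **Vanishing of higher cohomology is invariant under field extension** (Görtz–Wedhorn II, Cor. 22.91; Stacks 02KH):
for `φ : K → L` a homomorphism of fields, `g : X → Spec K` proper, `G` an affine-localizing (quasi-coherent) `𝒪_X`-module
and ANY cartesian square `X' = X ×_K Spec L` (`H : IsPullback k g' g (Spec φ)`),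
`Extⁿ⁺¹(𝒪_{X'}, k^*G) = 0 ↔ Extⁿ⁺¹(𝒪_X, G) = 0`. [cite: GortzWedhorn2023, Cor. 22.91 (p. 277)] [cite: StacksProject, Tag 02KH] -/
theorem subsingleton_ext_unit_succ_iff_of_isPullback_specMap [IsProper g] (hG : IsAffineLocalizing G) (n : ℕ) :
    Subsingleton (Ext.{1} (unitModule X') ((Scheme.Modules.pullback k).obj G) (n + 1))
      ↔ Subsingleton (Ext.{1} (unitModule X) G (n + 1)) :=
  subsingleton_ext_unit_succ_iff_of_faithfullyFlat_of_isProper H G hG (faithfullyFlat_appLE_specMap φ) n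

include H in
/-- **`dim_L Hⁿ(Č•(k⁻¹𝓤, k^*G)) = dim_K Hⁿ(Č•(𝓤, G))` under a field extension** (scalars: the rings `Γ(Spec K, 𝒪)`,
`Γ(Spec L, 𝒪)`), for a finite family `𝓤` with affine non-empty finite intersections and `G` affine-localizing.
[cite: GortzWedhorn2023, Cor. 22.91 (p. 277)] [cite: StacksProject, Tag 02KH] -/
theorem finrank_homology_cechComplex_eq_of_isPullback_specMap {ι : Type} [LinearOrder ι] [Fintype ι]
    (U : ι → X.Opens) (hUa : ∀ s : Finset ι, s.Nonempty → IsAffineOpen (cechOpen U s))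
    (hG : IsAffineLocalizing G) (n : ℤ) :
    Module.finrank Γ(Spec (.of L), ⊤)
        ((cechComplex (fun i => k ⁻¹ᵁ U i) ((Scheme.Modules.pullback k).obj G) g'.appTop.hom).homology n) =
      Module.finrank Γ(Spec (.of K), ⊤) ((cechComplex U G g.appTop.hom).homology n) := by
  letI := ((Spec.map (CommRingCat.ofHom φ)).appLE ⊤ ⊤ le_top).hom.toAlgebra
  letI : Field Γ(Spec (CommRingCat.of K), ⊤) := (isField_Γ_spec K).toField
  letI : Field Γ(Spec (CommRingCat.of L), ⊤) := (isField_Γ_spec L).toField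
  obtain ⟨E⟩ := nonempty_tensor_homology_cechComplex_linearEquiv_of_flat H U hUa G hG
    (faithfullyFlat_appLE_specMap φ).flat n
  rw [← E.finrank_eq, Module.finrank_baseChange]

include H in
/-- **`h⁰` is invariant under field extension**: `dim_L Γ(X', k^*G) = dim_K Γ(X, G)` for `g : X → Spec K` proper, `G`
affine-localizing and any cartesian square over `Spec L → Spec K` (scalars: the rings `Γ(Spec K, 𝒪)`, `Γ(Spec L, 𝒪)`,
sections in the `SecMod` currency of the (h2) chain; degree `0` of Görtz–Wedhorn II Cor. 22.91, via ★
`exists_tensor_secMod_top_linearEquiv_of_flat`). [cite: GortzWedhorn2023, Cor. 22.91 (p. 277)] [cite: EGAIII1, Prop. (1.4.15)] -/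
theorem finrank_secMod_top_eq_of_isPullback_specMap [IsProper g] (hG : IsAffineLocalizing G) :
    Module.finrank Γ(Spec (.of L), ⊤) (SecMod ((Scheme.Modules.pullback k).obj G) g'.appTop.hom ⊤) =
      Module.finrank Γ(Spec (.of K), ⊤) (SecMod G g.appTop.hom ⊤) := by
  obtain ⟨ι, _, _, U, hcov, hUa⟩ := exists_finite_affine_cover_cechOpen g
  letI := ((Spec.map (CommRingCat.ofHom φ)).appLE ⊤ ⊤ le_top).hom.toAlgebra
  letI : Field Γ(Spec (CommRingCat.of K), ⊤) := (isField_Γ_spec K).toField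
  letI : Field Γ(Spec (CommRingCat.of L), ⊤) := (isField_Γ_spec L).toField
  obtain ⟨E, -⟩ := exists_tensor_secMod_top_linearEquiv_of_flat H U hcov hUa G hG (faithfullyFlat_appLE_specMap φ).flat
  rw [← E.finrank_eq, Module.finrank_baseChange]

include H in
/-- **`h⁰` is invariant under field extension, field scalars**: with `Γ(X, G)` a `K`-vector space through
`g♯ ∘ ΓSpecIso⁻¹ : K → Γ(X, 𝒪_X)` (and likewise over `L`), `dim_L Γ(X', k^*G) = dim_K Γ(X, G)`.
[cite: GortzWedhorn2023, Cor. 22.91 (p. 277)] [cite: EGAIII1, Prop. (1.4.15)] -/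
theorem finrank_secMod_top_eq_of_isPullback_specMap' [IsProper g] (hG : IsAffineLocalizing G) :
    Module.finrank L (SecMod ((Scheme.Modules.pullback k).obj G)
        (g'.appTop.hom.comp (Scheme.ΓSpecIso (.of L)).inv.hom) ⊤) =
      Module.finrank K (SecMod G (g.appTop.hom.comp (Scheme.ΓSpecIso (.of K)).inv.hom) ⊤) := by
  have hK : Module.finrank K (SecMod G (g.appTop.hom.comp (Scheme.ΓSpecIso (.of K)).inv.hom) ⊤) =
      Module.finrank Γ(Spec (.of K), ⊤) (SecMod G g.appTop.hom ⊤) := by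
    refine congrArg Cardinal.toNat (rank_eq_of_equiv_equiv (Scheme.ΓSpecIso (.of K)).inv
      (AddEquiv.refl _) (Scheme.ΓSpecIso (.of K)).symm.commRingCatIsoToRingEquiv.bijective fun c m => ?_)
    rfl
  have hL : Module.finrank L (SecMod ((Scheme.Modules.pullback k).obj G)
        (g'.appTop.hom.comp (Scheme.ΓSpecIso (.of L)).inv.hom) ⊤) =
      Module.finrank Γ(Spec (.of L), ⊤) (SecMod ((Scheme.Modules.pullback k).obj G) g'.appTop.hom ⊤) := by
    refine congrArg Cardinal.toNat (rank_eq_of_equiv_equiv (Scheme.ΓSpecIso (.of L)).inv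
      (AddEquiv.refl _) (Scheme.ΓSpecIso (.of L)).symm.commRingCatIsoToRingEquiv.bijective fun c m => ?_)
    rfl
  rw [hK, hL]
  exact finrank_secMod_top_eq_of_isPullback_specMap φ H G hG

end Field

end Literature.AlgebraicGeometry.Modules
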